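import Summits.AtomisticToContinuum.Crystallization.Theses.SpectralChargeLedger
import Summits.AtomisticToContinuum.Crystallization.Theorems.ReggeStarCoercivityStarCoercivitySeparationRemoval

/-!
# Route `SpectralChargeLedger`, crux `SummedShellPricing` (stmt-AtomisticToContinuum-17044),
line `Sketch`: stub `stub_sepReduction` — SEPARATION IS REMOVABLE

If the summed shell pricing `κ·#B ≤ E_LJ(y) − N·e⋆` (`e⋆ = ⨅_Q e(Q)` over periodic
configurations, `B` any set of sites whose open punctured `13/10·a₀`-shell in `Set.range y` is NOT
`τ`-matched — after a linear isometry, bijectively — to the `12`-shell of `hcpStacking a₀ h₀` or of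
`fccStacking a₀ h₀`) holds at one cell `(a₀, h₀)` of the box for every `1/3`-SEPARATED finite
configuration, then it holds, with the same cell and a smaller price `κ' > 0`, for every
`δ`-separated finite configuration, `δ > 0` arbitrary: this is the crux `SummedShellPricing`.

PROOF (a port of `CoerciveTwoShellGapSepReduction.stub_sepReduction`, file
`PhononSlackCertificatesCoerciveTwoShellGapSepReduction.lean`, to K1's set-based first-shell
predicate; the predicate is only touched through two abstract lemmas over variable shell and
pattern sets, `not_good_of_forall_not_mem` and `good_succAbove_iff`).
(0) `N = 1`, `B = univ`: the shell of an isolated site is empty while both reference shells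
contain `triangularVec₁ a₀ = (a₀, 0, 0)` (`triangularVec₁_mem_shell`), so the site is unmatched,
and one particle has energy `0`; hence `κ ≤ −e⋆` and `e⋆ < 0`.
(1) Put `M := (2·(13/10)/δ + 1)³` and `κ' := min κ (−e⋆/(M+1)) > 0`, and prove the claim for
`δ`-separated `y : Fin N → ℝ³` by strong induction on `N` (`δ`-separation passes to
sub-configurations).  If `y` is `1/3`-separated: the hypothesis (`κ' ≤ κ`).  Otherwise there is a
closest pair `(i₀, j₀)` at distance `0 < r < 1/3`; delete `i₀`:
`E(y) = E(y ∖ i₀) + E^{i₀}(y)` (`separationRemoval_interactionEnergy_succAbove`) with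
`E^{i₀}(y) > 0` (`separationRemoval_siteEnergy_pos_of_closest`), and
`#B ≤ #bad(y) ≤ #bad(y ∖ i₀) + 1 + #{sites within 13/10 of y i₀}` (`separationRemoval_card_not_le`:
sites farther than `13/10 ≥ 13/10·a₀` from `y i₀` have the SAME shell set in `Set.range y` and in
`Set.range (y ∖ i₀)`, hence the same status — `good_succAbove_iff`), while by packing at most `M`
sites of the `δ`-separated `y ∖ i₀` lie within `13/10` of `y i₀` (`card_near_le`,
`card_le_of_separated_of_dist_le`).  With the induction hypothesis for `y ∖ i₀` and
`B' = bad(y ∖ i₀)`: `κ'·#B ≤ κ'·#bad(y ∖ i₀) + κ'·(M+1) ≤ (E(y ∖ i₀) − n·e⋆) − e⋆ < E(y) − (n+1)·e⋆`.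
No definitions (the matching predicate is abbreviated by a local `set` inside the proof only);
all `[folklore]`.
-/


noncomputable section

namespace Summit.AtomisticToContinuum.Crystallization.Theorems.SummedShellPricingSepReduction

open scoped BigOperators Classical
open Literature.MathematicalPhysics.StatisticalMechanics Literature.Geometry.DiscreteGeometry

/-! ### The matching predicate, abstractly: shell set `T`, pattern sets `P₁`, `P₂`, centre `q` -/

/-- **An empty shell matches no nonempty pattern** (a bijection would produce a shell point).
[folklore] -/
theorem not_good_of_forall_not_mem {T P₁ P₂ : Set (EuclideanSpace ℝ (Fin 3))}
    {q : EuclideanSpace ℝ (Fin 3)} {τ : ℝ} (hT : ∀ z, z ∉ T) (h₁ : P₁.Nonempty) (h₂ : P₂.Nonempty) :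
    ¬ ∃ A : EuclideanSpace ℝ (Fin 3) →ₗᵢ[ℝ] EuclideanSpace ℝ (Fin 3),
      (∃ e : ↥T ≃ ↥P₁, ∀ t : ↥T,
        dist ((t : EuclideanSpace ℝ (Fin 3)) - q) (A ((e t : ↥P₁) : EuclideanSpace ℝ (Fin 3))) ≤ τ) ∨
      (∃ e : ↥T ≃ ↥P₂, ∀ t : ↥T,
        dist ((t : EuclideanSpace ℝ (Fin 3)) - q) (A ((e t : ↥P₂) : EuclideanSpace ℝ (Fin 3))) ≤ τ) := by
  rintro ⟨-, ⟨e, -⟩ | ⟨e, -⟩⟩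
  · obtain ⟨p, hp⟩ := h₁
    exact hT _ (e.symm ⟨p, hp⟩).2
  · obtain ⟨p, hp⟩ := h₂
    exact hT _ (e.symm ⟨p, hp⟩).2

/-! ### The reference shells are nonempty -/

/-- `triangularVec₁ a = (a, 0, 0)` is a non-zero point of every Barlow stacking, of norm
`a < 13/10·a` (`0 < a`): the reference shells are nonempty. [folklore] -/
theorem triangularVec₁_mem_shell {a h : ℝ} (ha : 0 < a) (s : ℤ → ℤ) :
    triangularVec₁ a ∈ {p : EuclideanSpace ℝ (Fin 3) | p ∈ barlowStacking a h s ∧ p ≠ 0 ∧ ‖p‖ < 13 / 10 * a} := by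
  have hn : ‖triangularVec₁ a‖ = a := by
    rw [EuclideanSpace.norm_eq]
    simp [triangularVec₁, Fin.sum_univ_three, Real.sqrt_sq ha.le]
  refine ⟨?_, fun h0 => ?_, ?_⟩
  · have := barlowPos_mem (a := a) (h := h) (s := s) 0 1 0
    simpa [barlowPos] using this
  · rw [h0, norm_zero] at hn
    exact ha.ne hn
  · rw [hn]
    linarith

/-! ### Deleting one particle: far shells, near count -/

/-- **Far shells are unchanged by a deletion**: if `y (i₀.succAbove i')` is farther than
`13/10 ≥ r` from the deleted particle `y i₀`, the open punctured `r`-shell of `y (i₀.succAbove i')`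
in `Set.range y` equals its shell in `Set.range (y ∘ i₀.succAbove)`, so the matching predicates
agree (pure set equality; no injectivity needed). [folklore] -/
theorem good_succAbove_iff {n : ℕ} (y : Fin (n + 1) → EuclideanSpace ℝ (Fin 3)) (i₀ : Fin (n + 1))
    {i' : Fin n} {r : ℝ} (hr : r ≤ 13 / 10) (hfar : ¬ dist (y (i₀.succAbove i')) (y i₀) ≤ 13 / 10)
    (P₁ P₂ : Set (EuclideanSpace ℝ (Fin 3))) (τ : ℝ) :
    (∃ A : EuclideanSpace ℝ (Fin 3) →ₗᵢ[ℝ] EuclideanSpace ℝ (Fin 3),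
      (∃ e : ↥{z : EuclideanSpace ℝ (Fin 3) | z ∈ Set.range y ∧ z ≠ y (i₀.succAbove i') ∧
          dist z (y (i₀.succAbove i')) < r} ≃ ↥P₁,
        ∀ t : ↥{z : EuclideanSpace ℝ (Fin 3) | z ∈ Set.range y ∧ z ≠ y (i₀.succAbove i') ∧
          dist z (y (i₀.succAbove i')) < r},
          dist ((t : EuclideanSpace ℝ (Fin 3)) - y (i₀.succAbove i')) (A ((e t : ↥P₁) : EuclideanSpace ℝ (Fin 3))) ≤ τ) ∨
      (∃ e : ↥{z : EuclideanSpace ℝ (Fin 3) | z ∈ Set.range y ∧ z ≠ y (i₀.succAbove i') ∧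
          dist z (y (i₀.succAbove i')) < r} ≃ ↥P₂,
        ∀ t : ↥{z : EuclideanSpace ℝ (Fin 3) | z ∈ Set.range y ∧ z ≠ y (i₀.succAbove i') ∧
          dist z (y (i₀.succAbove i')) < r},
          dist ((t : EuclideanSpace ℝ (Fin 3)) - y (i₀.succAbove i')) (A ((e t : ↥P₂) : EuclideanSpace ℝ (Fin 3))) ≤ τ)) ↔
    (∃ A : EuclideanSpace ℝ (Fin 3) →ₗᵢ[ℝ] EuclideanSpace ℝ (Fin 3),
      (∃ e : ↥{z : EuclideanSpace ℝ (Fin 3) | z ∈ Set.range (y ∘ i₀.succAbove) ∧ z ≠ (y ∘ i₀.succAbove) i' ∧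
          dist z ((y ∘ i₀.succAbove) i') < r} ≃ ↥P₁,
        ∀ t : ↥{z : EuclideanSpace ℝ (Fin 3) | z ∈ Set.range (y ∘ i₀.succAbove) ∧ z ≠ (y ∘ i₀.succAbove) i' ∧
          dist z ((y ∘ i₀.succAbove) i') < r},
          dist ((t : EuclideanSpace ℝ (Fin 3)) - (y ∘ i₀.succAbove) i') (A ((e t : ↥P₁) : EuclideanSpace ℝ (Fin 3))) ≤ τ) ∨
      (∃ e : ↥{z : EuclideanSpace ℝ (Fin 3) | z ∈ Set.range (y ∘ i₀.succAbove) ∧ z ≠ (y ∘ i₀.succAbove) i' ∧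
          dist z ((y ∘ i₀.succAbove) i') < r} ≃ ↥P₂,
        ∀ t : ↥{z : EuclideanSpace ℝ (Fin 3) | z ∈ Set.range (y ∘ i₀.succAbove) ∧ z ≠ (y ∘ i₀.succAbove) i' ∧
          dist z ((y ∘ i₀.succAbove) i') < r},
          dist ((t : EuclideanSpace ℝ (Fin 3)) - (y ∘ i₀.succAbove) i') (A ((e t : ↥P₂) : EuclideanSpace ℝ (Fin 3))) ≤ τ)) := by
  -- adapted from `separationRemoval_shell_succAbove`
  -- (Summits/AtomisticToContinuum/Crystallization/Theorems/ReggeStarCoercivityStarCoercivitySeparationRemoval.lean)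
  have hS : {z : EuclideanSpace ℝ (Fin 3) | z ∈ Set.range y ∧ z ≠ y (i₀.succAbove i') ∧
        dist z (y (i₀.succAbove i')) < r} =
      {z : EuclideanSpace ℝ (Fin 3) | z ∈ Set.range (y ∘ i₀.succAbove) ∧ z ≠ y (i₀.succAbove i') ∧
        dist z (y (i₀.succAbove i')) < r} := by
    ext z
    simp only [Set.mem_setOf_eq]
    constructor
    · rintro ⟨⟨j, rfl⟩, hne, hd⟩
      rcases Fin.eq_self_or_eq_succAbove i₀ j with rfl | ⟨j', rfl⟩
      · refine absurd ?_ hfar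
        rw [dist_comm]
        linarith
      · exact ⟨⟨j', rfl⟩, hne, hd⟩
    · rintro ⟨⟨j', rfl⟩, hne, hd⟩
      exact ⟨⟨i₀.succAbove j', rfl⟩, hne, hd⟩
  rw [hS]
  exact Iff.rfl

/-- **Near count**: at most `(2·(13/10)/δ + 1)³` sites of a `δ`-separated configuration (`δ > 0`)
lie within `13/10` of a given point (`card_le_of_separated_of_dist_le`). [folklore] -/
theorem card_near_le {n : ℕ} (x : Fin n → EuclideanSpace ℝ (Fin 3)) {δ : ℝ} (hδ : 0 < δ)
    (hsep : ∀ i j : Fin n, i ≠ j → δ ≤ dist (x i) (x j)) (p : EuclideanSpace ℝ (Fin 3)) :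
    ((Finset.univ.filter fun i : Fin n => dist (x i) p ≤ 13 / 10).card : ℝ) ≤ (2 * (13 / 10) / δ + 1) ^ 3 := by
  -- adapted from `separationRemoval_card_flip_le`
  have hx : Function.Injective x := fun i j hij => by
    by_contra hne
    have := hsep i j hne
    rw [hij, dist_self] at this
    linarith
  set S := Finset.univ.filter fun i : Fin n => dist (x i) p ≤ 13 / 10 with hS
  rw [← Finset.card_image_of_injective S hx]
  have h := card_le_of_separated_of_dist_le (S.image x) p hδ (by norm_num : (0 : ℝ) ≤ 13 / 10)
    (fun c hc => ?_) (fun c hc d hd hcd => ?_)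
  · rwa [finrank_euclideanSpace, Fintype.card_fin] at h
  · obtain ⟨i, hi, rfl⟩ := Finset.mem_image.1 hc
    exact (Finset.mem_filter.1 hi).2
  · obtain ⟨i, -, rfl⟩ := Finset.mem_image.1 hc
    obtain ⟨j, -, rfl⟩ := Finset.mem_image.1 hd
    exact hsep i j fun h => hcd (by rw [h])

/-! ### The stub -/

/-- **Separation reduction** (line `Sketch` of crux `SummedShellPricing`,
item `stmt-AtomisticToContinuum-17044`): the summed shell pricing for `1/3`-SEPARATED finite
configurations at one cell `(a₀, h₀)` implies the crux for EVERY `δ > 0` (same cell), with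
`κ' = min κ (−e⋆/(M+1))`, `M = (2·(13/10)/δ + 1)³`: `N = 1` forces `κ ≤ −e⋆`; closest-pair
deletion by strong induction on `N` (`separationRemoval_interactionEnergy_succAbove`,
`separationRemoval_siteEnergy_pos_of_closest`, `separationRemoval_card_not_le`, `good_succAbove_iff`,
`card_near_le`). [folklore] -/
theorem stub_sepReduction :
    (∃ a₀ h₀ : ℝ, 47 / 50 ≤ a₀ ∧ a₀ ≤ 1 ∧ |h₀ - a₀ * Real.sqrt (2 / 3)| ≤ a₀ / 100 ∧
       ∀ τ : ℝ, 0 < τ → τ ≤ 1 → ∃ κ : ℝ, 0 < κ ∧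
         ∀ (N : ℕ) (y : Fin N → EuclideanSpace ℝ (Fin 3)), (∀ i j : Fin N, i ≠ j → (1 / 3 : ℝ) ≤ dist (y i) (y j)) →
           ∀ B : Finset (Fin N), (∀ i ∈ B,
             ¬ (∃ A : EuclideanSpace ℝ (Fin 3) →ₗᵢ[ℝ] EuclideanSpace ℝ (Fin 3),
                 (∃ e : ↥{z : EuclideanSpace ℝ (Fin 3) | z ∈ Set.range y ∧ z ≠ y i ∧ dist z (y i) < 13 / 10 * a₀} ≃
                     ↥{p : EuclideanSpace ℝ (Fin 3) | p ∈ hcpStacking a₀ h₀ ∧ p ≠ 0 ∧ ‖p‖ < 13 / 10 * a₀},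
                   ∀ t : ↥{z : EuclideanSpace ℝ (Fin 3) | z ∈ Set.range y ∧ z ≠ y i ∧ dist z (y i) < 13 / 10 * a₀},
                     dist ((t : EuclideanSpace ℝ (Fin 3)) - y i)
                       (A ((e t : ↥{p : EuclideanSpace ℝ (Fin 3) | p ∈ hcpStacking a₀ h₀ ∧ p ≠ 0 ∧ ‖p‖ < 13 / 10 * a₀}) : EuclideanSpace ℝ (Fin 3))) ≤ τ) ∨
                 (∃ e : ↥{z : EuclideanSpace ℝ (Fin 3) | z ∈ Set.range y ∧ z ≠ y i ∧ dist z (y i) < 13 / 10 * a₀} ≃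
                     ↥{p : EuclideanSpace ℝ (Fin 3) | p ∈ fccStacking a₀ h₀ ∧ p ≠ 0 ∧ ‖p‖ < 13 / 10 * a₀},
                   ∀ t : ↥{z : EuclideanSpace ℝ (Fin 3) | z ∈ Set.range y ∧ z ≠ y i ∧ dist z (y i) < 13 / 10 * a₀},
                     dist ((t : EuclideanSpace ℝ (Fin 3)) - y i)
                       (A ((e t : ↥{p : EuclideanSpace ℝ (Fin 3) | p ∈ fccStacking a₀ h₀ ∧ p ≠ 0 ∧ ‖p‖ < 13 / 10 * a₀}) : EuclideanSpace ℝ (Fin 3))) ≤ τ))) →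
           κ * (B.card : ℝ) ≤ interactionEnergy lennardJones y - (N : ℝ) * (⨅ Q : PeriodicConfiguration 3, Q.energyPerParticle lennardJones)) →
    Summit.AtomisticToContinuum.Crystallization.Theses.SpectralChargeLedger.SummedShellPricing := by
  -- adapted from `CoerciveTwoShellGapSepReduction.stub_sepReduction`
  -- (Summits/AtomisticToContinuum/Crystallization/Theorems/PhononSlackCertificatesCoerciveTwoShellGapSepReduction.lean)
  rintro ⟨a₀, h₀, ha, ha1, hh, hK⟩ δ hδ
  refine ⟨a₀, h₀, ha, ha1, hh, fun τ hτ hτ1 => ?_⟩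
  obtain ⟨κ, hκ, hKτ⟩ := hK τ hτ hτ1
  have ha0 : 0 < a₀ := by linarith
  set eP : ℝ := (⨅ Q : PeriodicConfiguration 3, Q.energyPerParticle lennardJones) with heP
  set P₁ : Set (EuclideanSpace ℝ (Fin 3)) :=
    {p : EuclideanSpace ℝ (Fin 3) | p ∈ hcpStacking a₀ h₀ ∧ p ≠ 0 ∧ ‖p‖ < 13 / 10 * a₀} with hP₁
  set P₂ : Set (EuclideanSpace ℝ (Fin 3)) :=
    {p : EuclideanSpace ℝ (Fin 3) | p ∈ fccStacking a₀ h₀ ∧ p ≠ 0 ∧ ‖p‖ < 13 / 10 * a₀} with hP₂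
  -- local abbreviation: site `i` of `x : Fin M → ℝ³` is `τ`-matched
  set Gd : (M : ℕ) → (Fin M → EuclideanSpace ℝ (Fin 3)) → Fin M → Prop := fun M x i =>
    ∃ A : EuclideanSpace ℝ (Fin 3) →ₗᵢ[ℝ] EuclideanSpace ℝ (Fin 3),
      (∃ e : ↥{z : EuclideanSpace ℝ (Fin 3) | z ∈ Set.range x ∧ z ≠ x i ∧ dist z (x i) < 13 / 10 * a₀} ≃ ↥P₁,
        ∀ t : ↥{z : EuclideanSpace ℝ (Fin 3) | z ∈ Set.range x ∧ z ≠ x i ∧ dist z (x i) < 13 / 10 * a₀},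
          dist ((t : EuclideanSpace ℝ (Fin 3)) - x i) (A ((e t : ↥P₁) : EuclideanSpace ℝ (Fin 3))) ≤ τ) ∨
      (∃ e : ↥{z : EuclideanSpace ℝ (Fin 3) | z ∈ Set.range x ∧ z ≠ x i ∧ dist z (x i) < 13 / 10 * a₀} ≃ ↥P₂,
        ∀ t : ↥{z : EuclideanSpace ℝ (Fin 3) | z ∈ Set.range x ∧ z ≠ x i ∧ dist z (x i) < 13 / 10 * a₀},
          dist ((t : EuclideanSpace ℝ (Fin 3)) - x i) (A ((e t : ↥P₂) : EuclideanSpace ℝ (Fin 3))) ≤ τ)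
    with hGd
  -- Step (0): an isolated particle is unmatched and has energy `0`, so `κ ≤ -e⋆ `
  have hP₁ne : P₁.Nonempty := ⟨_, triangularVec₁_mem_shell ha0 _⟩
  have hP₂ne : P₂.Nonempty := ⟨_, triangularVec₁_mem_shell ha0 _⟩
  have hκe : κ ≤ -eP := by
    have h1 := hKτ 1 (fun _ => 0) (fun i j hij => absurd (Subsingleton.elim i j) hij) Finset.univ
      (fun i _ => not_good_of_forall_not_mem
        (fun z hz => hz.2.1 (by obtain ⟨j, hj⟩ := hz.1; exact hj.symm)) hP₁ne hP₂ne)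
    rw [Finset.card_univ, Fintype.card_fin, interactionEnergy_of_subsingleton] at h1
    push_cast at h1
    linarith
  have he : eP < 0 := by linarith
  -- the constants
  set M : ℝ := (2 * (13 / 10) / δ + 1) ^ 3 with hM
  have hM0 : 0 ≤ M := by positivity
  set κ' : ℝ := min κ (-eP / (M + 1)) with hκ'
  have hκ'0 : 0 < κ' := lt_min hκ (div_pos (by linarith) (by positivity))
  have hκ'κ : κ' ≤ κ := min_le_left _ _
  have hMκ : κ' * (M + 1) ≤ -eP := by
    have := min_le_right κ (-eP / (M + 1))
    rwa [le_div_iff₀ (by positivity : (0 : ℝ) < M + 1)] at this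
  refine ⟨κ', hκ'0, ?_⟩
  show ∀ (N : ℕ) (y : Fin N → EuclideanSpace ℝ (Fin 3)), (∀ i j : Fin N, i ≠ j → δ ≤ dist (y i) (y j)) →
    ∀ B : Finset (Fin N), (∀ i ∈ B, ¬ Gd N y i) →
      κ' * (B.card : ℝ) ≤ interactionEnergy lennardJones y - (N : ℝ) * eP
  -- Steps (1)-(2): closest-pair deletion, strong induction on `N`
  intro N
  induction N using Nat.strong_induction_on with
  | _ N ih =>
  intro y hsep B hB
  have hy : Function.Injective y := fun i j hij => by
    by_contra hne
    have := hsep i j hne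
    rw [hij, dist_self] at this
    linarith
  by_cases hs : ∀ i j : Fin N, i ≠ j → (1 / 3 : ℝ) ≤ dist (y i) (y j)
  · -- separated: the hypothesis with the weaker constant
    have h := hKτ N y hs B hB
    have hB0 : (0 : ℝ) ≤ B.card := Nat.cast_nonneg _
    nlinarith [mul_le_mul_of_nonneg_right hκ'κ hB0]
  · -- a closest pair `(i₀, j₀)` at distance `< 1/3`; delete `i₀`
    push Not at hs
    obtain ⟨i₁, j₁, hij₁, hlt⟩ := hs
    obtain ⟨p, hp, hmin⟩ := Finset.exists_min_image Finset.univ.offDiag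
      (fun p : Fin N × Fin N => dist (y p.1) (y p.2)) ⟨(i₁, j₁), by simp [hij₁]⟩
    obtain ⟨i₀, j₀⟩ := p
    have hij₀ : i₀ ≠ j₀ := by simpa using hp
    have hr : 0 < dist (y i₀) (y j₀) := dist_pos.2 (hy.ne hij₀)
    have hsepr : ∀ k l, k ≠ l → dist (y i₀) (y j₀) ≤ dist (y k) (y l) := fun k l hkl =>
      hmin (k, l) (by simp [hkl])
    have hr3 : dist (y i₀) (y j₀) < 1 / 3 := (hsepr i₁ j₁ hij₁).trans_lt hlt
    obtain ⟨n, rfl⟩ : ∃ n, N = n + 1 := Nat.exists_eq_succ_of_ne_zero (Fin.pos i₀).ne'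
    set y' : Fin n → EuclideanSpace ℝ (Fin 3) := y ∘ i₀.succAbove with hy'
    have hsep' : ∀ i j : Fin n, i ≠ j → δ ≤ dist (y' i) (y' j) := fun i j hij =>
      hsep _ _ fun h => hij (Fin.succAbove_right_injective h)
    have hih := ih n (Nat.lt_succ_self n) y' hsep' (Finset.univ.filter fun i => ¬ Gd n y' i)
      fun i hi => (Finset.mem_filter.1 hi).2
    have hE : interactionEnergy lennardJones y =
        interactionEnergy lennardJones y' + siteEnergy lennardJones y i₀ :=
      separationRemoval_interactionEnergy_succAbove lennardJones y i₀
    have hsite : 0 < siteEnergy lennardJones y i₀ :=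
      separationRemoval_siteEnergy_pos_of_closest y hr hr3 hsepr hij₀ rfl
    -- the recount `#bad(y) ≤ #bad(y') + 1 + #near ≤ #bad(y') + 1 + M`
    set S : Finset (Fin n) := Finset.univ.filter fun i' : Fin n => dist (y' i') (y i₀) ≤ 13 / 10 with hS
    have hrec := separationRemoval_card_not_le i₀ (G := Gd (n + 1) y) (G' := Gd n y') S
      (fun i' hi' => good_succAbove_iff y i₀ (by linarith : 13 / 10 * a₀ ≤ 13 / 10)
        (by simpa [hS, hy'] using hi') P₁ P₂ τ)
    rw [Nat.card_eq_fintype_card, Fintype.card_subtype, Nat.card_eq_fintype_card,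
      Fintype.card_subtype] at hrec
    have hBle : B.card ≤ (Finset.univ.filter fun i => ¬ Gd (n + 1) y i).card :=
      Finset.card_le_card fun i hi => Finset.mem_filter.2 ⟨Finset.mem_univ _, hB i hi⟩
    have hSf : (S.filter (Gd n y')).card ≤ S.card := Finset.card_filter_le _ _
    have hSM : (S.card : ℝ) ≤ M := card_near_le y' hδ hsep' (y i₀)
    have hcast : (B.card : ℝ) ≤ ((Finset.univ.filter fun i => ¬ Gd n y' i).card : ℝ) + 1 + M := by
      have h2 : B.card ≤ (Finset.univ.filter fun i => ¬ Gd n y' i).card + 1 + S.card := by omega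
      have h3 : (B.card : ℝ) ≤ ((Finset.univ.filter fun i => ¬ Gd n y' i).card : ℝ) + 1 + S.card := by
        exact_mod_cast h2
      linarith
    push_cast at hih ⊢
    linarith [mul_le_mul_of_nonneg_left hcast hκ'0.le]

end Summit.AtomisticToContinuum.Crystallization.Theorems.SummedShellPricingSepReduction

end
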